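import Literature.NumberTheory.GaloisCohomology.Howard2004.DVRSettingEngineH159Proofs
import Literature.NumberTheory.GaloisCohomology.Howard2004.InertTransverseDecompositionOfUnitsProofs
import Literature.NumberTheory.GaloisCohomology.Howard2004.CasselsTateSkewPairingPackageProofs
import HarnessLib

/-!
# Howard 2004, Lemma 1.6.4 on a `DVRSetting`: the ENGINE binder `h159` (Prop. 1.5.9) for EVERY imaginary quadratic
# `K` with `p ∤ #𝓞_K^×` — the `d_K < -4`-free twin of `DVRSettingEngineH159Proofs.engine_h159` (proofs file)

Topic `NumberTheory/GaloisCohomology/Howard2004`.  THEOREMS ONLY: no definition, no named fact, no instance, no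
notation, no `sorry`.  B. Howard, *The Heegner point Kolyvagin system*, Compositio Math. **140** (2004) =
arXiv:1202.6340, Prop. 1.5.9 (arXiv Prop. 2.5.9, p. 10 L146 – p. 11 L13) as consumed by Lemma 1.6.4 (p. 12 L10–21).
`DVRSettingEngineH159Proofs.engine_h159` (x9-p1-w4 g17) delivers the engine binder `h159` under
`hd : NumberField.discr K < -4`, which enters ONLY through Prop. 1.1.9 / the counts / the tame generator at the inert
primes (`#Gal(K[ℓ]/K[1]) = ℓ + 1` needs `𝓞_K^× = {±1}`).  x9-p1-w3 g15's (HD-FREE) files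
(`InertTransverseDecompositionOfUnitsProofs`, `DVRSettingEngineLocalInputsOfUnitsProofs`) re-prove exactly those local
letters for EVERY imaginary quadratic `K` under `hu : ¬ p ∣ Nat.card (𝓞 K)ˣ` (the `p`-part of `Gal(K[ℓ]/K[1])` is what
matters; `p ∤ u_K` fails only at `(p, d_K) = (3, -3)`), the tame generator needing neither.  THIS FILE re-runs the proof of
`engine_h159` with the four `hd` call sites swapped for those twins (the two `S`-level one-liners of
`DVRSettingEngineLocalInputsOfUnitsProofs` are carried as PRIVATE copies so that this file depends on the landed
`InertTransverseDecompositionOfUnitsProofs` only):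

* **`DVRSetting.engine_h159_of_units`** — the binder `h159` VERBATIM (same ten hypotheses as `engine_h159` with `hd`
  replaced by `hu`).  Since `d_K < -4 ⇒ #𝓞_K^× = 2 ⇒ p ∤ #𝓞_K^×` for odd `p`
  (`DVRSetting.not_dvd_card_units_of_discr_lt`), `engine_h159` is the special case `hu := … hd`.

This is the form the closing theorem over the print-as-intended leaf `thm161_dvrKolyvaginBound_printIntended` (binders
`(p : R) ≠ 0`, `¬ p ∣ Nat.card (𝓞 K)ˣ`) consumes.  Cell `pub/bsd-print-x9`, print leaf G87 (stub `stub_h161` of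
stmt-BirchSwinnertonDyer-22642); seat `bsd-line-x10b-p1-w7` g10, brick (H159-HU).  `thm161_dvrKolyvaginBound` is NOT
proved here; no summit statement is proved; the Birch–Swinnerton-Dyer conjecture is not proved by any of this.
References: [Howard2004HeegnerKolyvagin] Prop. 1.5.9, Lemma 1.6.4, Prop. 1.1.9, §1.3 H.4, Def. 1.5.4;
[MilneADT2006] I Cor. 2.3, Thm. 4.10.
-/

set_option autoImplicit false

noncomputable section

open CategoryTheory Function NumberField IsDedekindDomain Field
open scoped NumberField Classical

namespace Literature.NumberTheory.GaloisCohomology.Howard2004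

open Literature.NumberTheory.GaloisRepresentations
open Literature.NumberTheory.GaloisRepresentations.DiscreteGaloisModule
open Literature.RingTheory.CompleteLocalRings
open Literature.NumberTheory.EllipticCurves
open IsDedekindDomain.HeightOneSpectrum

/-- The length of a module with finitely many elements is finite. [folklore] -/
private theorem length_ne_top_of_finite_aux {R M : Type*} [Ring R] [AddCommGroup M] [Module R M] [Finite M] :
    Module.length R M ≠ ⊤ := by
  haveI : IsArtinian R M := isArtinian_of_finite
  exact Module.length_ne_top

namespace DVRSetting

variable {p : ℕ} [Fact p.Prime] {K : Type} [Field K] [NumberField K]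
  {R : Type} [CommRing R] [IsDomain R] [IsDiscreteValuationRing R] [Algebra ℤ_[p] R]
  {N : ℕ → Type} [∀ k, AddCommGroup (N k)] [∀ k, TopologicalSpace (N k)]
  [∀ k, DiscreteTopology (N k)] [∀ k, Module R (N k)]
  {Rk : ℕ → Type} [∀ k, CommRing (Rk k)] [∀ k, IsLocalRing (Rk k)] [∀ k, TopologicalSpace (Rk k)]
  [∀ k, DiscreteTopology (Rk k)] [∀ k, Algebra ℤ_[p] (Rk k)] [∀ k, Algebra R (Rk k)]
  [∀ k, Module (Rk k) (N k)] [∀ k, IsScalarTower R (Rk k) (N k)]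
  {Nbar : Type} [AddCommGroup Nbar] [TopologicalSpace Nbar] [DiscreteTopology Nbar]
  [∀ k, Module (Rk k) Nbar]
  {Nq : ℕ → Finset (HeightOneSpectrum (𝓞 K)) → Type} [∀ k n, AddCommGroup (Nq k n)]
  [∀ k n, TopologicalSpace (Nq k n)] [∀ k n, DiscreteTopology (Nq k n)]
  [∀ k n, Module (Rk k) (Nq k n)] [∀ k n, Module R (Nq k n)]
  [∀ k n, IsScalarTower R (Rk k) (Nq k n)]

/-- **A tame generator at `q ∈ 𝓛` for EVERY imaginary quadratic `K`**: `σ₀ ∈ I_{K_q}` with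
`Γ_{K_q} = ⋃_i σ₀^i · (Γ_{K_q} ∩ Γ_{K[ℓ]})` — the binders `σ₀`, `hcyc` of the local files with NO hypothesis beyond
`S.SatisfiesH`. [cite: Howard2004HeegnerKolyvagin, §1.2 (arXiv:1202.6340 p. 6 L84–95)] [cite: GrossLMS1991, §3 (PDF p. 217 l. 1–3)] -/
private theorem exists_mem_absInertia_forall_pow_inv_mul_mem_localRingClassSubgroup_of_mem_L_aux
    (S : DVRSetting p K R N Rk Nbar Nq) (hy : S.SatisfiesH) {q : HeightOneSpectrum (𝓞 K)} (hq : q ∈ S.L) :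
    ∃ σ₀ : absoluteGaloisGroup (q.adicCompletion K), σ₀ ∈ absInertia (q.adicCompletion K) ∧
      ∀ σ : absoluteGaloisGroup (q.adicCompletion K), ∃ i : ℕ,
        (σ₀ ^ i)⁻¹ * σ ∈ localRingClassSubgroup (residueChar q) S.jbar q :=
  exists_forall_pow_inv_mul_mem_localRingClassSubgroup_of_isDegreeTwo' hy.imagQuad S.jbar
    (S.isDegreeTwo_of_mem_L hy hq)

/-- **Prop. 1.1.9 `R`-linearly at the level, in H159-LOC's shape (`hc`, `ef`, `etr`), for every imaginary quadratic `K`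
with `p ∤ #𝓞_K^×**: `R`-submodules `SVf`, `SVtr` of `H¹(K_q, T^{(j)})` with underlying subgroups `H¹_ur`, `H¹_tr`,
complementary, both `≃ₗ[R] (R/π^{e_j})²`.
[cite: Howard2004HeegnerKolyvagin, Prop. 1.1.9, §1.5, §1.6 (arXiv:1202.6340 p. 6 L17–25, p. 9 L105–108, p. 11 L33–44)] -/
private theorem exists_unramified_transverse_submodules_of_mem_levelPrimes_aux (S : DVRSetting p K R N Rk Nbar Nq)
    (hy : S.SatisfiesH) (hu : ¬ p ∣ Nat.card (𝓞 K)ˣ) {j : ℕ} {q : HeightOneSpectrum (𝓞 K)}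
    (hq : q ∈ S.levelPrimes j) :
    letI := galoisCohomology.moduleH1 ((S.T.ρ j).toLocal (Sum.inr q))
      ((S.T.hlin j).restrictField (Place.Completion (Sum.inr q)))
    ∃ SVf SVtr : Submodule R (galoisCohomology ((S.T.ρ j).toLocal (Sum.inr q)) 1),
      SVf.toAddSubgroup = unramifiedSubgroup (GaloisRep.toLocal q (S.T.ρ j)) 1 ∧
      SVtr.toAddSubgroup = transverseStructure p (S.T.ρ j) S.jbar (Sum.inr q) ∧
      IsCompl SVf SVtr ∧
      Nonempty (↥SVf ≃ₗ[R] (Fin 2 → R ⧸ Ideal.span {S.π ^ S.e j})) ∧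
      Nonempty (↥SVtr ≃ₗ[R] (Fin 2 → R ⧸ Ideal.span {S.π ^ S.e j})) := by
  haveI : Finite (N j) := S.finite_level hy j
  have hn : ↑({q} : Finset (HeightOneSpectrum (𝓞 K))) ⊆ S.levelPrimes j := by
    rw [Finset.coe_singleton, Set.singleton_subset_iff]; exact hq
  have hρv : DiscreteGaloisModule.IsScalarLinear R (GaloisRep.toLocal q (S.T.ρ j)) :=
    (S.T.hlin j).restrictField (Place.Completion (Sum.inr q))
  obtain ⟨Vtr, hVtr, hc, ⟨ef⟩, ⟨etr⟩⟩ :=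
    exists_transverse_submodule_isCompl_linearEquiv_of_isDegreeTwo_of_not_dvd_card_units p hy.imagQuad hu (S.T.ρ j)
      S.jbar (S.isDegreeTwo_of_mem_L hy hq.1) hρv
      (fun g x => S.toLocal_apply_eq_self_of_subset_levelPrimes hy hn (Finset.mem_singleton_self q) g x)
      (S.exists_pow_p_smul_eq_zero_level hy j) (S.residueChar_succ_smul_eq_zero_of_mem_levelPrimes hy hq)
  obtain ⟨eN⟩ := S.nonempty_level_linearEquiv_pi hy j
  exact ⟨DiscreteGaloisModule.unramifiedSubmodule hρv, Vtr, DiscreteGaloisModule.toAddSubgroup_unramifiedSubmodule hρv,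
    hVtr, hc, ⟨ef.trans eN⟩, ⟨etr.trans eN⟩⟩

/-- **The ENGINE binder `h159` on a `DVRSetting` for EVERY imaginary quadratic `K` with `p ∤ #𝓞_K^×`** — Howard's
Prop. 1.5.9 «`loc_λ(Stub^{(k)}(n)) = 0 ⟹ loc_λ(Stub^{(k)}(nλ)) = 0`» in the currency of
`StubLemmaInductionProofs.mem_stub_of_stubLemmaInduction_levels'` (`P k = S.enginePrimes k`,
`H k n = ↥(S.selmerModuleAt hy k n)`, `loc = S.locR` restricted, `Stub = S.stub hy hdec`), at every level `k`, every
`n ∈ 𝓝(𝓛^{(2k-1)})` and every `λ ∈ 𝓛^{(2k-1)} ∖ n`: the statement of `engine_h159` with `hd : d_K < -4` replaced by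
`hu : ¬ p ∣ Nat.card (𝓞 K)ˣ`.  Same proof, the Prop. 1.1.9 / count / tame-generator letters at the primes of `nλ` now
read from the (HD-FREE) twins `exists_forall_pow_inv_mul_mem_localRingClassSubgroup_of_isDegreeTwo'`,
`natCard_transverseStructure_mul_eq_of_isDegreeTwo_of_not_dvd_card_units`,
`exists_transverse_submodule_isCompl_linearEquiv_of_isDegreeTwo_of_not_dvd_card_units` (through the two private
`S`-level copies above).  Remaining binders (level-uniform, as in `engine_h159`):
`hPT`, the conjugation-datum letters `hI hφ hφI hφΛ hδ`, and `hpar`.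
[cite: Howard2004HeegnerKolyvagin, Prop. 1.5.9 (arXiv:1202.6340 Prop. 2.5.9, p. 10 L146 – p. 11 L13), Lemma 1.6.4 (p. 12 L10–21) and Prop. 1.1.9 (p. 6 L17–25)] [cite: MilneADT2006, Ch. I Cor. 2.3 and Thm. 4.10] -/
theorem engine_h159_of_units (S : DVRSetting p K R N Rk Nbar Nq) (hy : S.SatisfiesH)
    (hdec : S.HasLevelDecompositions hy) (hu : ¬ p ∣ Nat.card (𝓞 K)ˣ)
    (hPT : poitouTate_selmerStructure_duality K)
    (hI : ∀ v ∈ S.L, ∀ g ∈ absInertia (v.adicCompletion K), S.cd.φ v g ∈ absInertia ((S.cd.σ • v).adicCompletion K))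
    (hφ : ∀ v ∈ S.L, ∀ h ∈ localRingClassSubgroup (residueChar v) S.jbar v,
      S.cd.φ v h ∈ localRingClassSubgroup (residueChar v) S.jbar (S.cd.σ • v))
    (hφI : ∀ (v : HeightOneSpectrum (𝓞 K)) (hv : S.cd.σ • v = v), v ∈ S.L →
      ∀ g : absoluteGaloisGroup (v.adicCompletion K), ∃ i ∈ absInertia (v.adicCompletion K),
        (hv ▸ S.cd.φ v g : absoluteGaloisGroup (v.adicCompletion K)) = i * g)
    (hφΛ : ∀ (v : HeightOneSpectrum (𝓞 K)) (hv : S.cd.σ • v = v), v ∈ S.L →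
      ∀ g : absoluteGaloisGroup (v.adicCompletion K), ∃ l ∈ localRingClassSubgroup (residueChar v) S.jbar v,
        (hv ▸ S.cd.φ v g : absoluteGaloisGroup (v.adicCompletion K)) = l * g⁻¹)
    (hδ : ∀ (k : ℕ) (v : HeightOneSpectrum (𝓞 K)), v ∈ S.enginePrimes k → ∀ u w : N k,
      (S.D k).e u ((S.T.ρ k) (S.cd.δ v) w) = (S.D k).e w ((S.T.ρ k) (S.cd.δ v) u))
    (hpar : letI := fun k => galoisCohomology.moduleH1 (S.T.ρ k) (S.T.hlin k)
      ∀ (k : ℕ) (n : Finset (HeightOneSpectrum (𝓞 K))) (q : HeightOneSpectrum (𝓞 K)),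
        ↑n ⊆ S.enginePrimes k → q ∈ S.enginePrimes k → q ∉ n →
        Module.finrank (R ⧸ R ∙ S.π) ↥(Submodule.torsionBy R ↥(S.selmerModuleAt hy k n) S.π) % 2 =
          Module.finrank (R ⧸ R ∙ S.π) ↥(Submodule.torsionBy R ↥(S.selmerModuleAt hy k (insert q n)) S.π) % 2) :
    letI := fun k => galoisCohomology.moduleH1 (S.T.ρ k) (S.T.hlin k)
    letI := fun k (v : Place K) =>
      galoisCohomology.moduleH1 ((S.T.ρ k).toLocal v) ((S.T.hlin k).restrictField (Place.Completion v))
    ∀ (k : ℕ) (n : Finset (HeightOneSpectrum (𝓞 K))) (q : HeightOneSpectrum (𝓞 K)),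
      ↑n ⊆ S.enginePrimes k → q ∈ S.enginePrimes k → q ∉ n →
      S.stub hy hdec k n ≤ LinearMap.ker ((S.locR k (Sum.inr q)).domRestrict (S.selmerModuleAt hy k n)) →
      S.stub hy hdec k (insert q n) ≤
        LinearMap.ker ((S.locR k (Sum.inr q)).domRestrict (S.selmerModuleAt hy k (insert q n))) := by
  intro k n q hn hq hqn hstub
  letI instG : Module R (galoisCohomology (S.T.ρ k) 1) := galoisCohomology.moduleH1 (S.T.ρ k) (S.T.hlin k)
  letI instL : ∀ v : Place K, Module R (galoisCohomology ((S.T.ρ k).toLocal v) 1) := fun v =>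
    galoisCohomology.moduleH1 ((S.T.ρ k).toLocal v) ((S.T.hlin k).restrictField (Place.Completion v))
  have hp : p.Prime := Fact.out
  haveI : Finite (N k) := S.finite_level hy k
  haveI : Finite (Rk k) := S.finite_coeffLevel hy k
  haveI : Module.Free (Rk k) (N k) := (hy.h0 k).1
  haveI : Module.Finite (Rk k) (N k) := Module.finite_of_finrank_eq_succ (n := 1) (hy.h0 k).2
  haveI : NeZero (p ^ S.e k) := ⟨pow_ne_zero _ hp.ne_zero⟩
  have hqL : q ∈ S.L := hq.1
  have hqfix : S.cd.σ • q = q := S.sigma_smul_eq_self_of_mem_L hy hqL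
  have hqlev : q ∈ S.levelPrimes k := S.enginePrimes_subset_levelPrimes hy k hq
  have hnqlev : (↑(insert q n) : Set (HeightOneSpectrum (𝓞 K))) ⊆ S.levelPrimes k := by
    rw [Finset.coe_insert]
    exact Set.insert_subset hqlev (hn.trans (S.enginePrimes_subset_levelPrimes hy k))
  have hnq : (↑(insert q n) : Set (HeightOneSpectrum (𝓞 K))) ⊆ S.enginePrimes k := by
    rw [Finset.coe_insert]; exact Set.insert_subset hq hn
  have hdeg : ∀ v ∈ S.enginePrimes k, IsDegreeTwo v := fun v hv => ((Set.mem_iInter.1 hv.2.1) k).1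
  have hek : 0 < S.e k := hy.e_zero.trans_le (hy.e_strictMono.monotone (Nat.zero_le k))
  -- `p^{e_k}` kills `R_k` and `T^{(k)}`; `(ℓ+1)` kills `T^{(k)}` at an engine prime
  have hpe : ((p : ℕ) : R) ^ S.e k ∈ IsLocalRing.maximalIdeal R ^ S.e k :=
    S.natCast_pow_mem_maximalIdeal_pow_of_le hy le_rfl
  have hRk : ∀ r : Rk k, p ^ S.e k • r = 0 := S.natCast_pow_smul_levelRing_eq_zero hy k hpe
  have hNk : ∀ m : N k, p ^ S.e k • m = 0 := fun m => by
    rw [← Nat.cast_smul_eq_nsmul R, Nat.cast_pow]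
    exact hy.killed k _ hpe m
  have hNk' : ∀ x : N k, ∃ m : ℕ, p ^ m • x = 0 := fun x => ⟨S.e k, hNk x⟩
  have hRp : IsPrimaryTorsion p (Rk k) := fun r => ⟨S.e k, hRk r⟩
  have hodd : Odd (p ^ S.e k) := (hp.odd_of_ne_two hy.p_odd).pow
  have hℓT : ∀ v ∈ S.enginePrimes k, ∀ x : N k, (residueChar v + 1) • x = 0 := by
    intro v hv x
    obtain ⟨a, ha⟩ := Ideal.mem_span_singleton'.mp hv.2.2.1
    have hs : ((p : ℕ) : R) ^ (2 * S.e k - 1) ∈ IsLocalRing.maximalIdeal R ^ S.e k :=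
      S.natCast_pow_mem_maximalIdeal_pow_of_le hy (by omega)
    rw [← Nat.cast_smul_eq_nsmul R, ← ha, mul_smul, hy.killed k _ hs x, smul_zero]
  have hϖ : Irreducible S.π := (IsDiscreteValuationRing.irreducible_iff_uniformizer S.π).mpr hy.unif
  have h2 : IsUnit (2 : R) := S.isUnit_two_base hy
  have hsoc : ∀ a b : Rk k, S.π • a = 0 → S.π • b = 0 → a ≠ 0 → ∃ c : R, b = c • a :=
    Literature.Algebra.Module.exists_smul_eq_of_uniformizer_smul_eq_zero hϖ (hy.algebraMap_surjective k)
  -- the trivialisation `exp = log⁻¹` of `μ_{p^{e_k}}`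
  have hpK : (p : K) ≠ 0 := Nat.cast_ne_zero.mpr hp.ne_zero
  obtain ⟨log, hlogbij, hlogχ, -⟩ := exists_compatible_muLog K p hpK
  let Lg : MuCarrier K (p ^ S.e k) ≃+ ZMod (p ^ S.e k) := AddEquiv.ofBijective (log (S.e k)) (hlogbij (S.e k))
  let exp : ZMod (p ^ S.e k) →+ MuCarrier K (p ^ S.e k) := Lg.symm
  have hexpb : Bijective exp := Lg.symm.bijective
  have hexp : ∀ (g : absoluteGaloisGroup K) (x : ZMod (p ^ S.e k)),
      exp (cyclotomicCharacterModPow K p (S.e k) g * x) = mu K (p ^ S.e k) g (exp x) := fun g x => by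
    apply Lg.injective
    change Lg (Lg.symm _) = log (S.e k) (mu K _ g (Lg.symm x))
    rw [AddEquiv.apply_symm_apply, hlogχ, show log (S.e k) (Lg.symm x) = Lg (Lg.symm x) from rfl,
      AddEquiv.apply_symm_apply]
  -- the Frobenius character of `R_k`, `Θ` bijective, `H²`-detection
  obtain ⟨lam, hbij⟩ := exists_addMonoidHom_zmod_bijective_mul_compr₂ (R := Rk k)
    (S.isPrincipal_maximalIdeal_levelRing hy k) hRk
  have hlam : ∀ (z : ℤ_[p]) (a : Rk k), lam (algebraMap ℤ_[p] (Rk k) z * a) = PadicInt.toZModPow (S.e k) z * lam a :=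
    apply_algebraMap_mul_eq_toZModPow_mul hRk lam
  have hfrob : Bijective fun c : Rk k => DualityDatum.lamMul lam c := hbij
  have hΘ : Bijective ((S.D k).toTateDual lam hlam exp hexp) :=
    (S.D k).toTateDual_bijective lam hlam exp hexp hexpb (bijective_comp_linearMap_of_free lam hbij)
  have hdet : ∀ (v : Place K) (z : galoisCohomology ((S.D k).twistOne.toLocal v) 2),
      (∀ b : Rk k, cohomologyMap ((S.D k).expLamLocalHom (DualityDatum.lamMul lam b)
        (DualityDatum.lamMul_semilinear lam hlam b) exp hexp v) 2 z = 0) → z = 0 := by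
    intro v z hz
    rcases v with w | v
    · exact galoisCohomology_two_toLocal_inl_eq_zero_of_odd (S.D k).twistOne w hodd hRk z
    · refine (S.D k).eq_zero_of_forall_cohomologyMap_expLam_eq_zero_of_finite exp hexp hRk hexpb v z ?_
      intro lam' hlam'
      obtain ⟨b, hb⟩ := hfrob.2 lam'
      subst hb
      exact hz b
  obtain ⟨inv, hperf, hPT0, -, hSC⟩ := hPT (p ^ S.e k)
  -- the scalar structures and the modified Selmer structures `F(m)`, `F_q(n)`, `F^q(n)`
  have hρ : (S.T.ρ k).IsScalarLinear (Rk k) := hy.scalarLinear k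
  have hcR : (S.t k).cond.IsScalarStable (S.T.hlin k) := fun v r x hx => hy.cond_smul k v r ⟨x, hx, rfl⟩
  have htrR : (transverseStructure p (S.T.ρ k) S.jbar).IsScalarStable (S.T.hlin k) :=
    isScalarStable_transverseStructure p (S.T.hlin k) S.jbar
  have hmodR : ∀ a b c : Finset (HeightOneSpectrum (𝓞 K)),
      ((S.t k).cond.modify (transverseStructure p (S.T.ρ k) S.jbar) a b c).IsScalarStable (S.T.hlin k) :=
    fun a b c => hcR.modify (S.T.hlin k) htrR a b c
  have hn_fix : ∀ v ∈ n, S.cd.σ • v = v := fun v hv => S.sigma_smul_eq_self_of_mem_L hy (hn hv).1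
  have hnq_fix : ∀ v ∈ insert q n, S.cd.σ • v = v := fun v hv => S.sigma_smul_eq_self_of_mem_L hy (hnq hv).1
  have hσmem : ∀ v ∈ insert q n, S.cd.σ • v ∈ insert q n := fun v hv => by rw [hnq_fix v hv]; exact hv
  have htrivAt : ∀ v ∈ insert q n, ∀ (g : absoluteGaloisGroup (v.adicCompletion K)) (x : N k),
      GaloisRep.toLocal v (S.T.ρ k) g x = x := fun v hv g x =>
    S.toLocal_apply_eq_self_of_subset_enginePrimes hy (k := k) (j := k) (by omega) hnq hv g x
  have htrivAt' : ∀ v ∈ insert q n, ∀ (g : absoluteGaloisGroup ((S.cd.σ • v).adicCompletion K)) (x : N k),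
      GaloisRep.toLocal (S.cd.σ • v) (S.T.ρ k) g x = x := fun v hv g x =>
    S.toLocal_apply_eq_self_of_subset_enginePrimes hy (k := k) (j := k) (by omega) hnq (hσmem v hv) g x
  have htrivTwAt : ∀ v ∈ insert q n, ∀ (g : absoluteGaloisGroup (v.adicCompletion K)) (x : N k),
      GaloisRep.toLocal v (S.cd.twist (S.T.ρ k)) g x = x := fun v hv =>
    S.cd.toLocal_twist_apply_eq_self (S.T.ρ k) v (htrivAt' v hv)
  have hS : ∀ v : HeightOneSpectrum (𝓞 K), (Sum.inr v : Place K) ∉ ((S.t k).modify S.jbar {q} ∅ n).Sigma →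
      ((p ^ S.e k : ℕ) : 𝓞 K) ∉ v.asIdeal ∧ GaloisRep.IsUnramifiedAt v (S.T.ρ k) := fun v hv =>
    S.not_mem_and_isUnramifiedAt_of_not_mem_Sigma k (S.e k) v (fun h => hv (Finset.mem_union_left _ h))
  have hqS : (Sum.inr q : Place K) ∈ ((S.t k).modify S.jbar {q} ∅ n).Sigma := by
    change _ ∈ (S.t k).Sigma ∪ _
    simp
  have h𝓡S : ((S.t k).cond.modify (transverseStructure p (S.T.ρ k) S.jbar) {q} ∅ n).IsUnramifiedOutside
      ((S.t k).modify S.jbar {q} ∅ n).Sigma :=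
    ((S.t k).modify S.jbar {q} ∅ n).isHoward.isUnramifiedOutside
  -- H.4 for `F(n)`: `hy.h4` off `n`, the transverse self-orthogonality on `n`
  have horth : (S.D k).IsSelfOrthogonal ((S.t k).cond.modify (transverseStructure p (S.T.ρ k) S.jbar) ∅ ∅ n) := by
    refine (S.D k).isSelfOrthogonal_of_eq_off (S.t k).cond _ (↑n : Set (HeightOneSpectrum (𝓞 K)))
      (fun v hv => ?_) (fun v hv => ?_) (hy.h4 k) (fun v hv => ?_)
    · rw [Finset.mem_coe] at hv ⊢
      rw [hn_fix v hv]; exact hv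
    · rw [Finset.mem_coe] at hv
      exact SelmerStructure.modify_inr_of_not_mem _ _ (Finset.notMem_empty _) (Finset.notMem_empty _) hv
    · rw [Finset.mem_coe] at hv
      have hv' : v ∈ insert q n := Finset.mem_insert_of_mem hv
      have hfix : S.cd.σ • v = v := hn_fix v hv
      have h𝓖v : (S.t k).cond.modify (transverseStructure p (S.T.ρ k) S.jbar) ∅ ∅ n (Sum.inr v) =
          transverseStructure p (S.T.ρ k) S.jbar (Sum.inr v) :=
        SelmerStructure.modify_inr_of_mem_transverse _ _ (Finset.notMem_empty _) (Finset.notMem_empty _) hv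
      obtain ⟨σ₀, -, hcyc⟩ :=
        exists_forall_pow_inv_mul_mem_localRingClassSubgroup_of_isDegreeTwo' hy.imagQuad S.jbar (hdeg v (hn hv))
      refine (S.D k).isSelfOrthogonalAt_of_transverse lam hlam exp hexp hNk hΘ inv hperf (residueChar v) S.jbar v _
        (by rw [h𝓖v, transverseStructure_inr]; rfl) (by rw [hfix, h𝓖v, transverseStructure_inr]; rfl)
        (htrivAt v hv') (htrivAt' v hv') (htrivTwAt v hv') hNk' hodd hRk σ₀ hcyc (hφ v (hn hv).1) ?_
      rw [hfix, h𝓖v]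
      exact natCard_transverseStructure_mul_eq_of_isDegreeTwo_of_not_dvd_card_units p hy.imagQuad hu (S.T.ρ k) S.jbar
        (hdeg v (hn hv)) rfl (htrivAt v hv') (htrivAt v hv') hNk' (hℓT v (hn hv))
  have hstab : ∀ v : HeightOneSpectrum (𝓞 K), v ≠ q → ∀ b : Rk k,
      ∀ a ∈ (S.t k).cond.modify (transverseStructure p (S.T.ρ k) S.jbar) ∅ ∅ n (Sum.inr v),
      galoisCohomology.scalarMapH1 ((S.T.ρ k).toLocal (Sum.inr v)) (DualityDatum.isScalarLinear_toLocal hρ (Sum.inr v)) b a ∈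
        (S.t k).cond.modify (transverseStructure p (S.T.ρ k) S.jbar) ∅ ∅ n (Sum.inr v) :=
    fun v _ b a ha => ((hy.isScalarStable_cond k).modify hρ (isScalarStable_transverseStructure p hρ S.jbar)
      ∅ ∅ n) (Sum.inr v) b ha
  have hinf : ∀ (w : InfinitePlace K) (c : galoisCohomology (S.T.ρ k) 1),
      galoisCohomology.localization (S.T.ρ k) (Sum.inl w) 1 c = 0 := S.localization_inl_eq_zero_level hy k
  have h𝓕q : (S.t k).cond (Sum.inr q) = unramifiedSubgroup (GaloisRep.toLocal q (S.T.ρ k)) 1 :=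
    (S.t k).cond_inr_eq_of_mem (by rw [hy.primes_eq k]; exact hqL)
  have h𝒯q : transverseStructure p (S.T.ρ k) S.jbar (Sum.inr q) =
      transverseCondition p (S.T.ρ k) (residueChar q) S.jbar q := by
    rw [transverseStructure_inr]; rfl
  have hqq : q ∈ insert q n := Finset.mem_insert_self q n
  obtain ⟨σ₀, -, hcyc⟩ := S.exists_mem_absInertia_forall_pow_inv_mul_mem_localRingClassSubgroup_of_mem_L_aux hy hqL
  -- `H¹(K_q, T^{(k)}) = H¹_f ⊕ H¹_tr` `R`-linearly, both `≅ (R/π^{e_k})²` (Prop. 1.1.9 at the level, x9-p1-w3)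
  obtain ⟨SVf, SVtr, hSVf0, hSVtr, hc, hef, hetr⟩ :=
    S.exists_unramified_transverse_submodules_of_mem_levelPrimes_aux hy hu hqlev
  have hSVf : SVf.toAddSubgroup = (S.t k).cond (Sum.inr q) := hSVf0.trans h𝓕q.symm
  -- the global `R`-submodules: `H¹_{F(n)}`, `H¹_{F(nq)}`, `H¹_{F_q(n)}`, `loc_q H¹_{F^q(n)}`
  let S𝓢 : Submodule R (galoisCohomology (S.T.ρ k) 1) :=
    galoisCohomology.submoduleOfStable (S.T.hlin k)
      ((S.t k).cond.modify (transverseStructure p (S.T.ρ k) S.jbar) ∅ {q} n).selmerGroup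
      (fun r _ hx => SelmerStructure.scalarMapH1_mem_selmerGroup (S.T.hlin k) (hmodR ∅ {q} n) r hx)
  let S𝓡 : Submodule R (galoisCohomology (S.T.ρ k) 1) :=
    galoisCohomology.submoduleOfStable (S.T.hlin k)
      ((S.t k).cond.modify (transverseStructure p (S.T.ρ k) S.jbar) {q} ∅ n).selmerGroup
      (fun r _ hx => SelmerStructure.scalarMapH1_mem_selmerGroup (S.T.hlin k) (hmodR {q} ∅ n) r hx)
  let SA : Submodule R (galoisCohomology ((S.T.ρ k).toLocal (Sum.inr q)) 1) := S𝓡.map (S.locR k (Sum.inr q))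
  have hSA : SA.toAddSubgroup =
      ((S.t k).cond.modify (transverseStructure p (S.T.ρ k) S.jbar) {q} ∅ n).selmerGroup.map
        (galoisCohomology.localization (S.T.ρ k) (Sum.inr q) 1) := by
    ext x
    simp only [SA, S𝓡, Submodule.mem_toAddSubgroup, Submodule.mem_map, AddSubgroup.mem_map,
      galoisCohomology.mem_submoduleOfStable_iff, locR_apply]
  have hS₁ : (S.selmerModuleAt hy k n).toAddSubgroup =
      ((S.t k).cond.modify (transverseStructure p (S.T.ρ k) S.jbar) ∅ ∅ n).selmerGroup := rfl
  have hS₂ : (S.selmerModuleAt hy k (insert q n)).toAddSubgroup =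
      ((S.t k).cond.modify (transverseStructure p (S.T.ρ k) S.jbar) ∅ ∅ (insert q n)).selmerGroup := rfl
  have hS𝓢 : S𝓢.toAddSubgroup =
      ((S.t k).cond.modify (transverseStructure p (S.T.ρ k) S.jbar) ∅ {q} n).selmerGroup := rfl
  have hf : ∀ c, S.locR k (Sum.inr q) c = galoisCohomology.localization (S.T.ρ k) (Sum.inr q) 1 c := fun _ => rfl
  -- the two structure decompositions, same `ε` (Prop. 1.5.5), `λ = stubLength`
  obtain ⟨ε₁, hε₁, M₁, _, _, _, ⟨θ₁⟩, -, hlam₁⟩ := S.exists_linearEquiv_decomposition hy hdec k n hn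
  obtain ⟨ε₂, hε₂, M₂, _, _, _, ⟨θ₂⟩, -, hlam₂⟩ := S.exists_linearEquiv_decomposition hy hdec k (insert q n) hnq
  obtain rfl : ε₁ = ε₂ :=
    S.epsilon_eq_of_linearEquiv_decompositions hy k n q hn hq hqn hε₁ hε₂ ⟨θ₁⟩ ⟨θ₂⟩ (hpar k n q hn hq hqn)
  have hM₁ : Module.length R M₁ = (S.stubLength hy hdec k n : ℕ∞) := by
    rw [hlam₁, ENat.coe_toNat length_ne_top_of_finite_aux]
  have hM₂ : Module.length R M₂ = (S.stubLength hy hdec k (insert q n) : ℕ∞) := by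
    rw [hlam₂, ENat.coe_toNat length_ne_top_of_finite_aux]
  haveI : Finite (R ⧸ IsLocalRing.maximalIdeal R ^ S.e k) := by
    haveI : Finite (IsLocalRing.ResidueField R) := hy.coeffRing.finite_residueField
    exact CompleteLocalRing.finite_quotient_maximalIdeal_pow (R := R) (S.e k)
  have hQ : Module.length R (R ⧸ IsLocalRing.maximalIdeal R ^ S.e k) =
      ((Module.length R (R ⧸ IsLocalRing.maximalIdeal R ^ S.e k)).toNat : ℕ∞) :=
    (ENat.coe_toNat length_ne_top_of_finite_aux).symm
  -- Prop. 1.5.9 at `q` (Frobenius form), instantiated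
  have key := (S.D k).smul_le_ker_of_smul_le_ker_of_inert_local_frob lam hlam exp hexp hϖ h2 hsoc (S.T.hlin k) hρ
    hNk hRp inv hPT0 hSC hperf hΘ hfrob hdet ((S.t k).modify S.jbar {q} ∅ n).Sigma hS (S.t k).cond
    (transverseStructure p (S.T.ρ k) S.jbar) n hqfix hqn hqS h𝓡S (fun v _ => horth v) hstab hinf
    (residueChar q) S.jbar h𝓕q h𝒯q (htrivAt q hqq) (htrivAt' q hqq) (htrivTwAt q hqq) hNk' hodd hRk (hI q hqL)
    (hφ q hqL) σ₀ hcyc (hφI q hqfix hqL) (hφΛ q hqfix hqL) (hδ k q hq) (S.locR k (Sum.inr q))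
    (S.selmerModuleAt hy k n) (S.selmerModuleAt hy k (insert q n)) S𝓢 SA SVf SVtr hf hS₁ hS₂ hS𝓢 hSA hSVf hSVtr
    hc hef hetr ε₁ _ (S.stubLength hy hdec k n) (S.stubLength hy hdec k (insert q n)) ⟨θ₁⟩ ⟨θ₂⟩ hQ hM₁ hM₂
  rw [show S.stub hy hdec k n = Ideal.span {S.π ^ S.stubLength hy hdec k n} • ⊤ from rfl,
    ideal_span_singleton_smul_top_le_ker_domRestrict_iff] at hstub
  rw [show S.stub hy hdec k (insert q n) = Ideal.span {S.π ^ S.stubLength hy hdec k (insert q n)} • ⊤ from rfl,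
    ideal_span_singleton_smul_top_le_ker_domRestrict_iff]
  exact key hstub


end DVRSetting

end Literature.NumberTheory.GaloisCohomology.Howard2004

end
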